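import Mathlib.GroupTheory.GroupAction.Basic
import Mathlib.Tactic.Group
import Mathlib.GroupTheory.Index
import Mathlib.Logic.Relation
import Literature.AnabelianGeometry.EtaleTheta.CyclotomicEnvelope
import HarnessLib

/-!
# [SemiAnbd] Prop 5.2 (i) / Def 5.1 (i)(c): AUTOMATIC congruence-continuity of an outer action — the generic
# group theory behind «follows from the various finiteness assumptions» (pigeonhole + rigidity of close
# equivariant pairs)

Mochizuki, *Semi-graphs of anabelioids*, Publ. RIMS **42** (2006) 221–322, §5: Def 5.1 (i) p. 62 (ms) / p. 289
(PRIMS), Prop 5.2 (i) p. 63 / p. 291 and its proof p. 64 l. 67–74 / p. 292 l. 13–17: «Assertions (i), (ii) follow from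
the various finiteness assumptions in our definition of a "continuous action" [cf. Definition 5.1, (i); the fact that
`𝒢` is coherent].» [cite: MochizukiSemiAnbd2006, Prop 5.2 (i), p. 63]

PROOF-ONLY file (abc-iut cell, layer L3, row «T54-HCCT-PRODUCER» of abc-iut-L3-lead δ7 (7) / δ23; seat
abc-iut-w4-d085 gen 10; piece (P1) of the SHAPES memo `HOME/staging/w4/w4-d085/g10/SHAPES-T54-HCCT.md`).  No
definition, no instance, no new named fact; Mathlib + the tree's `TopOut`/`contMulAut` (`CyclotomicEnvelope.lean`) only.

CONTEXT.  The T54 capstone v9 (`ArithThm54CharCoresCapstoneV9.lean`, p488210) keeps ONE design binder of the outer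
model `π₁^temp(𝒢) ⋊^out Π_A`: TEMPERED congruence-continuity `hCCt` — near `1` in `Π_A`, `ρ′ a` has a representative
congruent to the identity modulo the TREE level `ker (D.projAut n)`, whose quotient `Gal(𝒢_{∞,n}/𝒢)` is an
infinite discrete group.  abc-iut-w4-d029's `exists_nhds_forall_rep_congr_of_forall_finiteIndex_isOpen`
(`ArithOuterActionStronglyCompleteCongruence.lean`, p457557) produces this from strong completeness of `Π_A` for
every characteristic subgroup of FINITE index and records that no finite-index argument on `Π_A` alone reaches a
subgroup of infinite index.  Print's one-sentence proof of Prop 5.2 (i) is an AUTOMATIC-CONTINUITY argument: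
finitely many candidate lift / transport data at a finite characteristic level force the induced outer action on
`Gal(𝒢_{∞,n}/𝒢)` to take finitely many values on an open subgroup.  This file lands the two generic pieces of that
argument and the glue between them:

* §1 `exists_nhds_forall_rep_congr_of_finite_invariant` — PIGEONHOLE: for ANY subgroup `C ≤ G` the set
  `S_C := {a | ρ′ a has a representative φ with φ(y)·y⁻¹ ∈ C for all y}` is a subgroup (p457557's construction
  needs neither normality nor finite index nor stability), and `S_C` is a neighbourhood of `1` as soon as some
  finite-index `S′ ≤ Π_A` carries a FINITE-valued invariant `f` with `f a = f b → b⁻¹ a ∈ S_C` (`a, b ∈ S′`):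
  then `[S′ : S_C ⊓ S′] ≤ #ι`, so `S_C ⊓ S′` has finite index and is open by strong completeness.  p457557's theorem
  is the case `S′ = Π_A`, `f a :=` the induced self-map of the finite set `G ⧸ C`.
* §2 `exists_finite_forall_closeEquivariant_conj` — RIGIDITY OF CLOSE EQUIVARIANT PAIRS: let `Γ` act on a
  set `X` carrying a `Γ`-invariant relation `R` («adjacency») which is connected and locally finite, with
  FINITE stabilisers, and let the finite set `D ⊆ X` meet every orbit.  Then there is a FINITE `Σ ⊆ Γ ∖ {1}` such
  that for every NORMAL `Λ ⊴ Γ` disjoint from `Σ`, every pair (`ψ : Γ → Γ`, `t : X → X`) with `t (γ • x) = ψ γ • t x`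
  and `R x y → R (t x) (t y)` which is `Λ`-CLOSE to the identity (`t x ∈ Λ • x`, `ψ γ · γ⁻¹ ∈ Λ`) is conjugation by
  ONE element `λ₀ ∈ Λ`: `t = (λ₀ • ·)` and `ψ γ = λ₀ γ λ₀⁻¹`.  (Normalise at `x₀ ∈ D`; normality of `Λ` carries the
  exclusion of the transporters between distinct neighbours of points of `D` to all of `X`, so `t = λ₀ • ·` by
  induction along `R`-paths; then `ψ γ · γ⁻¹` lands in a conjugate of `Λ ∩ Stab(x₀) = {1}`.)  No van Kampen /
  Bass–Serre presentation and no generation lemma is used.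
* §3 `exists_rep_congr_of_forall_apply_eq_conj_mul` — GLUE: a bi-continuous automorphism that is INNER modulo a
  normal subgroup `C` (`Ψ y = g₀ y g₀⁻¹ c_y`, `c_y ∈ C`) has, in its outer class, a representative congruent to the
  identity modulo `C`.

INTENDED USE (pieces (P2)/(P3) of the memo, NOT in this file): `Γ := Gal(𝒢_{∞,n}/𝒢)` acting on the level-`ker projAut n`
coset semi-graph of the T54 presentation (a locally finite tree with finite stabilisers and finitely many orbits),
`Λ := ` the image of a deep finite characteristic level `ker π_m` (cofinality makes it avoid `Σ`), `t` the map a GRAPHIC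
representative (`hrep` + the produced branch transport, p460259) induces, `f a :=` its transport conjugators modulo
`ker π_m`; then §2 + §3 give the hypothesis of §1 and §1 gives `hCCt` at level `n`.  HONEST LABEL: generic lemmas;
nothing here is specific to semi-graphs of anabelioids, nothing of [SemiAnbd] is discharged by this file alone; no
side taken on [IUTchIII] Cor. 3.12; typed ≠ proved.
-/

namespace Literature.AnabelianGeometry.SemiGraphs

open Topology Filter Literature.AnabelianGeometry.EtaleTheta
open scoped Pointwise

/-! ### §1. Pigeonhole: a finite-valued invariant detecting the congruence subgroup makes it open -/

section Pigeonhole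

variable {G : Type*} [Group G] [TopologicalSpace G] {PA : Type*} [Group PA] [TopologicalSpace PA]

/-- **Automatic congruence-continuity, pigeonhole half** ([SemiAnbd] Prop 5.2 (i) proof, «the various finiteness
assumptions»): let `ρ′ : Π_A → Out_top(G)` be any homomorphism, `Π_A` strongly complete (every finite-index subgroup
open), `C ≤ G` ANY subgroup, `S′ ≤ Π_A` of finite index, and `f : Π_A → ι` with `ι` FINITE such that for `a, b ∈ S′`
with `f a = f b` the class `ρ′ (b⁻¹ a)` has a representative congruent to the identity modulo `C`.  Then every `a`
in some neighbourhood of `1` has a representative `φ` of `ρ′ a` with `φ(y)·y⁻¹ ∈ C` for all `y`.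
[cite: MochizukiSemiAnbd2006, Prop 5.2 (i), p. 63] -/
theorem exists_nhds_forall_rep_congr_of_finite_invariant (ρ' : PA →* TopOut G)
    (hsc : ∀ H : Subgroup PA, H.FiniteIndex → IsOpen (H : Set PA))
    (C : Subgroup G) (S' : Subgroup PA) [S'.FiniteIndex] {ι : Type*} [Finite ι] (f : PA → ι)
    (hf : ∀ a ∈ S', ∀ b ∈ S', f a = f b →
      ∃ φ : contMulAut G, TopOut.mk G φ = ρ' (b⁻¹ * a) ∧ ∀ y : G, (φ : MulAut G) y * y⁻¹ ∈ C) :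
    ∃ U ∈ 𝓝 (1 : PA), ∀ a ∈ U, ∃ φ : contMulAut G, TopOut.mk G φ = ρ' a ∧
      ∀ y : G, (φ : MulAut G) y * y⁻¹ ∈ C := by
  classical
  -- the congruence subgroup `S_C` (abc-iut-w4-d029's construction; no hypothesis on `C` is needed)
  let S : Subgroup PA :=
    { carrier := {a | ∃ φ : contMulAut G, TopOut.mk G φ = ρ' a ∧ ∀ y : G, (φ : MulAut G) y * y⁻¹ ∈ C}
      one_mem' := ⟨1, by rw [map_one, map_one], fun y => by
        rw [show ((1 : contMulAut G) : MulAut G) y = y from rfl, mul_inv_cancel]; exact C.one_mem⟩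
      mul_mem' := by
        rintro a b ⟨φ, hφ, hφC⟩ ⟨ψ, hψ, hψC⟩
        refine ⟨φ * ψ, by rw [map_mul, map_mul, hφ, hψ], fun y => ?_⟩
        have : ((φ * ψ : contMulAut G) : MulAut G) y * y⁻¹ =
            ((φ : MulAut G) ((ψ : MulAut G) y) * ((ψ : MulAut G) y)⁻¹) * ((ψ : MulAut G) y * y⁻¹) := by
          rw [Subgroup.coe_mul, MulAut.mul_apply]; group
        rw [this]
        exact C.mul_mem (hφC _) (hψC y)
      inv_mem' := by
        rintro a ⟨φ, hφ, hφC⟩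
        refine ⟨φ⁻¹, by rw [map_inv, map_inv, hφ], fun y => ?_⟩
        set w : G := ((φ⁻¹ : contMulAut G) : MulAut G) y with hw
        have hy : (φ : MulAut G) w = y := by
          rw [hw, InvMemClass.coe_inv, ← MulAut.mul_apply, mul_inv_cancel]; rfl
        have : w * y⁻¹ = ((φ : MulAut G) w * w⁻¹)⁻¹ := by rw [hy]; group
        rw [this]
        exact C.inv_mem (hφC w) }
  -- two elements of `S′` with the same invariant lie in one left coset of `S`
  have key : ∀ a b : S', f a = f b → (QuotientGroup.mk b : S' ⧸ S.subgroupOf S') = QuotientGroup.mk a := by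
    intro a b hab
    apply QuotientGroup.eq.mpr
    rw [Subgroup.mem_subgroupOf]
    change ((b : PA)⁻¹ * a) ∈ S
    exact hf a a.2 b b.2 hab
  -- hence `S′ ⧸ (S ⊓ S′)` injects into the finite `ι`
  haveI : Finite (S' ⧸ S.subgroupOf S') :=
    Finite.of_injective (fun q : S' ⧸ S.subgroupOf S' => f (q.out : S')) fun q q' h => by
      have := key _ _ h
      rw [QuotientGroup.out_eq', QuotientGroup.out_eq'] at this
      exact this.symm
  haveI hfi : (S.subgroupOf S').FiniteIndex := Subgroup.finiteIndex_of_finite_quotient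
  -- so `S ⊓ S′` has finite index in `Π_A`, and is open by strong completeness
  have hidx : (S ⊓ S').index ≠ 0 := by
    rw [← Subgroup.relIndex_mul_index (inf_le_right : S ⊓ S' ≤ S'), Subgroup.inf_relIndex_right]
    exact mul_ne_zero hfi.index_ne_zero Subgroup.FiniteIndex.index_ne_zero
  haveI : (S ⊓ S').FiniteIndex := ⟨hidx⟩
  exact ⟨(S ⊓ S' : Subgroup PA), (hsc _ inferInstance).mem_nhds (S ⊓ S').one_mem, fun a ha => ha.1⟩

end Pigeonhole

/-! ### §2. Rigidity of close equivariant pairs on a connected, locally finite `Γ`-set with finite stabilisers -/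

section Rigidity

variable {Γ : Type*} [Group Γ] {X : Type*} [MulAction Γ X]

/-- Transporters are finite when stabilisers are: `{γ | γ • y = y'}` is empty or a translate of `Stab(y)`.
[folklore] -/
private theorem finite_transporter (hstab : ∀ x : X, (MulAction.stabilizer Γ x : Set Γ).Finite) (y y' : X) :
    {γ : Γ | γ • y = y'}.Finite := by
  by_cases h : ∃ γ₀ : Γ, γ₀ • y = y'
  · obtain ⟨γ₀, hγ₀⟩ := h
    refine ((hstab y).image fun s => γ₀ * s).subset ?_
    intro γ hγ
    refine ⟨γ₀⁻¹ * γ, ?_, by group⟩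
    change (γ₀⁻¹ * γ) • y = y
    rw [mul_smul, hγ, ← hγ₀, inv_smul_smul]
  · push Not at h
    convert Set.finite_empty
    ext γ
    simpa using h γ

/-- **Automatic congruence-continuity, rigidity half** ([SemiAnbd] Prop 5.2 (i) proof made explicit): let `Γ` act
on `X` preserving a relation `R` («adjacency») that is connected (`R`-paths join any two points) and locally finite, with
finite stabilisers, and let
the finite `D ⊆ X` meet every orbit.  Then there is a FINITE set `Σ ⊆ Γ ∖ {1}` such that for every NORMAL subgroup
`Λ` disjoint from `Σ`, every pair (`ψ : Γ → Γ`, `t : X → X`) with `t (γ • x) = ψ γ • t x` and `R x y → R (t x) (t y)`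
that is `Λ`-close to the identity (`t x ∈ Λ • x` for all `x`, `ψ γ · γ⁻¹ ∈ Λ` for all `γ`) is conjugation by ONE
`λ₀ ∈ Λ`: `t x = λ₀ • x` and `ψ γ = λ₀ γ λ₀⁻¹`.  (`Σ` = the transporters between distinct `R`-neighbours of points of
`D`, and the non-trivial stabiliser elements of points of `D`.) [cite: MochizukiSemiAnbd2006, Prop 5.2 (i), p. 63] -/
theorem exists_finite_forall_closeEquivariant_conj (R : X → X → Prop)
    (hR : ∀ (γ : Γ) (x y : X), R x y → R (γ • x) (γ • y))
    (hconn : ∀ x y, Relation.ReflTransGen R x y) (hloc : ∀ x, {y | R x y}.Finite)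
    (hstab : ∀ x : X, (MulAction.stabilizer Γ x : Set Γ).Finite)
    (D : Set X) (hD : D.Finite) (hDne : D.Nonempty) (horb : ∀ x, ∃ d ∈ D, ∃ γ : Γ, γ • d = x) :
    ∃ E : Set Γ, E.Finite ∧ (1 : Γ) ∉ E ∧
      ∀ (Λ : Subgroup Γ), Λ.Normal → Disjoint (Λ : Set Γ) E →
        ∀ (ψ : Γ → Γ) (t : X → X),
          (∀ (γ : Γ) (x : X), t (γ • x) = ψ γ • t x) → (∀ x y, R x y → R (t x) (t y)) →
          (∀ x, ∃ l ∈ Λ, t x = l • x) → (∀ γ, ψ γ * γ⁻¹ ∈ Λ) →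
            ∃ l₀ ∈ Λ, (∀ x, t x = l₀ • x) ∧ ∀ γ, ψ γ = l₀ * γ * l₀⁻¹ := by
  classical
  -- the exclusion set
  let E₁ : Set Γ := ⋃ d ∈ D, ⋃ y ∈ {y | R d y}, ⋃ y' ∈ {y | R d y}, {γ | γ • y = y' ∧ y ≠ y'}
  let E₂ : Set Γ := ⋃ d ∈ D, {γ | γ • d = d ∧ γ ≠ 1}
  refine ⟨E₁ ∪ E₂, ?_, ?_, ?_⟩
  · refine Set.Finite.union ?_ ?_
    · refine hD.biUnion fun d _ => (hloc d).biUnion fun y _ => (hloc d).biUnion fun y' _ => ?_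
      exact (finite_transporter hstab y y').subset fun γ hγ => hγ.1
    · refine hD.biUnion fun d _ => (hstab d).subset fun γ hγ => ?_
      exact hγ.1
  · rintro (h | h)
    · simp only [E₁, Set.mem_iUnion, Set.mem_setOf_eq, one_smul] at h
      obtain ⟨_, _, _, _, _, _, h, h'⟩ := h
      exact h' h
    · simp only [E₂, Set.mem_iUnion, Set.mem_setOf_eq] at h
      obtain ⟨_, _, _, h⟩ := h
      exact h rfl
  intro Λ hΛ hdisj ψ t hequiv hRt hclose hψ
  obtain ⟨x₀, hx₀⟩ := hDne
  obtain ⟨l₀, hl₀, ht₀⟩ := hclose x₀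
  -- Step A: `t = l₀ • ·` everywhere, by induction along `R`-paths from `x₀`
  have hA : ∀ x, t x = l₀ • x := by
    intro x
    induction hconn x₀ x with
    | refl => exact ht₀
    | @tail x y _ hxy ih =>
      obtain ⟨d, hd, γ, rfl⟩ := horb x
      obtain ⟨l, hl, hty⟩ := hclose y
      -- pull back to the neighbourhood of `d`
      set y₁ : X := γ⁻¹ • y with hy₁
      have hdy₁ : R d y₁ := by
        have := hR γ⁻¹ _ _ hxy
        rwa [inv_smul_smul] at this
      set μ : Γ := γ⁻¹ * (l₀⁻¹ * l) * γ with hμ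
      have hμΛ : μ ∈ Λ := by
        have h1 : l₀⁻¹ * l ∈ Λ := Λ.mul_mem (Λ.inv_mem hl₀) hl
        have := hΛ.conj_mem _ h1 γ⁻¹
        simpa [hμ, mul_assoc] using this
      have hdμ : R d (μ • y₁) := by
        have h0 := hR (γ⁻¹ * l₀⁻¹) _ _ (hRt _ _ hxy)
        rw [ih, hty] at h0
        have eL : (γ⁻¹ * l₀⁻¹) • l₀ • γ • d = d := by
          rw [smul_smul, smul_smul, show γ⁻¹ * l₀⁻¹ * l₀ * γ = 1 by group, one_smul]
        have eR : (γ⁻¹ * l₀⁻¹) • l • y = μ • y₁ := by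
          rw [hy₁, hμ, smul_smul, smul_smul]
          congr 1
          group
        rwa [eL, eR] at h0
      -- `μ` moves the neighbour `y₁` of `d` to a neighbour of `d`; exclusion forces it to fix `y₁`
      have hfix : μ • y₁ = y₁ := by
        by_contra hne
        have hmem : μ ∈ E₁ := by
          simp only [E₁, Set.mem_iUnion, Set.mem_setOf_eq]
          exact ⟨d, hd, y₁, hdy₁, μ • y₁, hdμ, rfl, fun h => hne h.symm⟩
        exact Set.disjoint_left.mp hdisj hμΛ (Or.inl hmem)
      -- translate back
      rw [hty]
      have : (γ * μ * γ⁻¹) • y = y := by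
        rw [mul_smul, mul_smul, ← hy₁, hfix, hy₁, smul_inv_smul]
      have e2 : γ * μ * γ⁻¹ = l₀⁻¹ * l := by rw [hμ]; group
      rw [e2, mul_smul] at this
      -- `l₀⁻¹ l • y = y` gives `l • y = l₀ • y`
      have := congrArg (l₀ • ·) this
      simpa only [smul_inv_smul] using this
  refine ⟨l₀, hl₀, hA, fun γ => ?_⟩
  -- Step B: `ψ γ = l₀ γ l₀⁻¹` from equivariance at `x₀` and the exclusion of `Stab(x₀) ∖ {1}`
  have h1 : (ψ γ * l₀) • x₀ = (l₀ * γ) • x₀ := by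
    rw [mul_smul, mul_smul, ← ht₀, ← hequiv, hA]
  set ν : Γ := (l₀ * γ)⁻¹ * (ψ γ * l₀) with hν
  have hνfix : ν • x₀ = x₀ := by
    rw [hν, mul_smul, h1, inv_smul_smul]
  have hνΛ : ν ∈ Λ := by
    -- `ν = γ⁻¹ (l₀⁻¹ (ψγ γ⁻¹) (γ l₀ γ⁻¹)) γ`
    have h2 : l₀⁻¹ * (ψ γ * γ⁻¹) * (γ * l₀ * γ⁻¹) ∈ Λ :=
      Λ.mul_mem (Λ.mul_mem (Λ.inv_mem hl₀) (hψ γ)) (hΛ.conj_mem _ hl₀ γ)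
    have := hΛ.conj_mem _ h2 γ⁻¹
    simpa [hν, mul_assoc] using this
  have hν1 : ν = 1 := by
    by_contra hne
    have hmem : ν ∈ E₂ := by
      simp only [E₂, Set.mem_iUnion, Set.mem_setOf_eq]
      exact ⟨x₀, hx₀, hνfix, hne⟩
    exact Set.disjoint_left.mp hdisj hνΛ (Or.inr hmem)
  have hνeq : l₀ * γ = ψ γ * l₀ := by
    rw [hν] at hν1
    exact inv_mul_eq_one.mp hν1
  calc ψ γ = ψ γ * l₀ * l₀⁻¹ := by group
    _ = l₀ * γ * l₀⁻¹ := by rw [← hνeq]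

end Rigidity

/-! ### §3. Glue: inner modulo `C` ⇒ a representative of the same outer class congruent to the identity -/

section Glue

variable {G : Type*} [Group G] [TopologicalSpace G] [IsTopologicalGroup G]

/-- **Glue**: if a bi-continuous automorphism `Ψ` of `G` is inner MODULO a normal subgroup `C` — `Ψ y = g₀ y g₀⁻¹ c_y`
with `c_y ∈ C` — then its outer class contains a representative congruent to the identity modulo `C`, namely
`conj(g₀)⁻¹ ∘ Ψ`.  (With §2 read in `Γ = G ⧸ C`: «`ψ` inner by `λ₀`» lifts to this hypothesis.)
[cite: MochizukiSemiAnbd2006, Prop 5.2 (i), p. 63] -/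
theorem exists_rep_congr_of_forall_apply_eq_conj_mul (C : Subgroup G) [C.Normal] (Ψ : contMulAut G) (g₀ : G)
    (h : ∀ y : G, ∃ c ∈ C, (Ψ : MulAut G) y = g₀ * y * g₀⁻¹ * c) :
    ∃ Ψ' : contMulAut G, TopOut.mk G Ψ' = TopOut.mk G Ψ ∧ ∀ y : G, (Ψ' : MulAut G) y * y⁻¹ ∈ C := by
  -- the inner automorphism `conj g₀` as a bi-continuous automorphism
  let κ : contMulAut G := ⟨MulAut.conj g₀, innerAut_le_contMulAut G ⟨g₀, rfl⟩⟩
  have hκ : TopOut.mk G κ = 1 := by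
    rw [TopOut.mk, QuotientGroup.mk'_apply, QuotientGroup.eq_one_iff]
    exact ⟨g₀, rfl⟩
  refine ⟨κ⁻¹ * Ψ, by rw [map_mul, map_inv, hκ, inv_one, one_mul], fun y => ?_⟩
  obtain ⟨c, hc, hy⟩ := h y
  have : ((κ⁻¹ * Ψ : contMulAut G) : MulAut G) y = g₀⁻¹ * (Ψ : MulAut G) y * g₀ := by
    rw [Subgroup.coe_mul, MulAut.mul_apply, InvMemClass.coe_inv]
    change (MulAut.conj g₀).symm _ = _
    rw [MulAut.conj_symm_apply]
  rw [this, hy]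
  have e : g₀⁻¹ * (g₀ * y * g₀⁻¹ * c) * g₀ * y⁻¹ = y * (g₀⁻¹ * c * g₀⁻¹⁻¹) * y⁻¹ := by group
  rw [e]
  have hc' : g₀⁻¹ * c * g₀⁻¹⁻¹ ∈ C := (inferInstance : C.Normal).conj_mem c hc g₀⁻¹
  exact (inferInstance : C.Normal).conj_mem _ hc' y

end Glue

end Literature.AnabelianGeometry.SemiGraphs
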